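import Summits.HodgeConjecture.HodgeConjecture.Theorems.F0P3cStCharTSJacCartanTerminus         -- ★ C8 `tubeJacobianSocket_compactCartan` (LH5-p02): the socket at every COMPACT Cartan
import Summits.HodgeConjecture.HodgeConjecture.Theorems.F0P3cStCharTSWeylHypJacobianCartanM    -- ★ (J6) FILE 7 `tubeJacobianLocal_cartan_Gqs_vanDijkWeight_sq` (LH6-p04): the socket at `M`
import Summits.HodgeConjecture.HodgeConjecture.Theorems.F0P3cStCharTSTubeJacobianTransport     -- ★ (Q9) `tubeJacobianLocal_of_mulEquiv_map_nnreal` + kit + `map_conjFamily_eq_conjFamily` (A-p12)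
import Summits.HodgeConjecture.HodgeConjecture.Theorems.F0P3cStCharTSCartanAll                 -- ★ brings `exists_isRegularElt_centralizer_eq_cmTorus`, `exists_conj_cmTorus_of_not_isCompact_centralizer`
import Summits.HodgeConjecture.HodgeConjecture.Theorems.F0P3cStCharTSDGFieldReg                -- ★ `charpoly_discr_units_conj` (LH4-p02); brings ★ DG-FIELD `dgFormula_eq_of_unit_rel`, `dgFormula_eq_zero_of_not_isUnit_discr`, `exists_unit_rel_iff_isUnit_discr`
import Summits.HodgeConjecture.HodgeConjecture.Theorems.F0P3cStCharTSVanDijkHC                 -- ★ `exists_unit_mul_det_sq_eq_discr_iff`, `coe_sqrt_sqrt_unitModulusChar_eq_vanDijkWeight_re`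
import Summits.HodgeConjecture.HodgeConjecture.Theorems.F0P3cStCharTSVanDijkWeylSymm           -- ★ `exists_weylElt`, `vanDijkWeight_eq_zero_of_not`
import HarnessLib

/-!
# F0 · P3c · ROAD «UP-TR» brick (N4-A): THE LOCAL TUBE-JACOBIAN SOCKET AT **ANY** CARTAN SUBGROUP `T = Z(γ₀)` OF `U(Φ₃)(L⁺_v)` — compact (★ C8) or a conjugate of
# the split torus `M` (★ (J6) FILE 7 transported along `Int(x)` by ★ (Q9)) (Harish-Chandra 1970 Lemma 22; Rogawski 1990 §12.5 p. 182, §3.6 p. 29)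

Cell `pub/hodgecm-mathlib`, crux H413 = `stmt-HodgeConjecture-24833` (lane `--supports … --as helper`); seat LH10-p01 (g8); ROAD «UP-TR» v2 (holder F0P3-p02 (g23)) §B brick
(N4) «TUBE-ANY-CARTAN-G», FILE A of 2.  THEOREMS ONLY; sorry-free; no definition ∕ instance ∕ notation ∕ named fact; ★-only imports; axioms TRIO.

WHY.  The assembly (A-3) of ROAD «UP-TR» integrates over the `G`-Cartan `ψ(T_H) = Z_G(ψ γ₀)` attached to an `H`-torus `T_H` and an admissible embedding `ψ` ((N2b′)); that Cartan
is compact or a conjugate `x M x⁻¹` of the split torus, in general NOT a member of a chosen system of representatives.  ★ (E1b) `lintegral_cartanSet_eq_of_tubeJacobian_local` gives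
the tube (Weyl) formula at any `T = Z(γ₀)` modulo the local tube-Jacobian socket `hJacLoc`; ★ C8 pays the socket at every COMPACT `Z(γ₀)`, ★ (J6) FILE 7 at `T = M`.  This file pays it
at EVERY Cartan: **`tubeJacobianSocket_cartan`** — C8's head with the compactness binder deleted, in (E1b)'s `ν (Φ '' (A₀ ×ˢ V))` letters, weight the C8 letter
`√(∏_w |disc χ_t|_w · (∏_w |det t|_w)⁻²)`.  Non-compact case: `Z(γ₀) = x M x⁻¹` (★ `exists_conj_cmTorus_of_not_isCompact_centralizer`); along `e := Int(x⁻¹) : G ≃* G` the data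
`(T, ν, tT, Φ)` go to `(M, e_* ν, (e|_T)_* tT, Φ_M)` and ★ (Q9) `tubeJacobianLocal_of_mulEquiv_map_nnreal` pulls the `M`-socket (★ (J6) FILE 7 at the transported Haar data, its weight
hypothesis `hDM` discharged by §1 `sqrt_dgRadicand_coe_torus_eq_vanDijkWeight_re_sq`) back to `T`; `(e|_T)_* tT` has mass one on `compactCore M` by ★ `image_compactCore`.
HONEST LABEL: count-neutral; UP-TR block consequents move only at the rider editions; organs 2 = 2; h413 registry untouched; HC_CM is proved only modulo the printed
citations until rung 0 closes.

## References
* [HarishChandra1970] Harish-Chandra (notes by G. van Dijk), *Harmonic analysis on reductive p-adic groups*, LNM 162 (1970), Part V §4 Lemma 22 (the Jacobian of conjugation).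
* [Rogawski1990] J. D. Rogawski, *Automorphic Representations of Unitary Groups in Three Variables*, Ann. of Math. Stud. 123 (1990), §12.5 p. 182; §3.6 pp. 28–31.
-/

set_option autoImplicit false
-- the mandated namespace has the single-problem summit's repeated segment (`HodgeConjecture.HodgeConjecture`)
set_option linter.dupNamespace false

noncomputable section

open MeasureTheory Measure Set Filter Topology Function NumberField IsDedekindDomain Matrix
open Literature.MeasureTheory.Group
open Literature.NumberTheory.Automorphic Literature.NumberTheory.Automorphic.UnitaryGroup Literature.NumberTheory.Rogawski1990
open Literature.NumberTheory.GaloisRepresentations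
open Summit.HodgeConjecture.HodgeConjecture.Cruxes.H413
open Summit.HodgeConjecture.HodgeConjecture.Cruxes.H413.F0P3cStCharTSWeylHypMeasure
open Summit.HodgeConjecture.HodgeConjecture.Cruxes.H413.F0P3cStCharTSWeylCartanRadial
open Summit.HodgeConjecture.HodgeConjecture.Cruxes.H413.F0P3cStCharTSTubeJacobianTransport
open scoped ENNReal NNReal MatrixGroups Pointwise

namespace Summit.HodgeConjecture.HodgeConjecture.Cruxes.H413.F0P3cStCharTSUpTrTubeSocketAnyCartan

section CM

variable (L : Type) [Field L] [NumberField L] [IsCMField L] (v : HeightOneSpectrum (𝓞 ↥(maximalRealSubfield L)))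

/-! ## §1 The weight letter: a class function; its value on the split torus `M` -/

/-- **The weight letter `√(∏_w |disc χ_g|_w · (∏_w |det g|_w)⁻²)` is a class function** on `U(Φ₃)(L⁺_v)` (`discr ∘ charpoly` and `det` are conjugation invariant, ★
`charpoly_discr_units_conj`, Mathlib `det_units_conj`). [cite: Rogawski1990, §3.1 p. 19; §12.5 p. 182] -/
theorem sqrt_dgRadicand_conj (g h : Gqs L v) :
    NNReal.sqrt
        ((∏ w : PlacesOver L v, IsNonarchimedeanLocalField.normAbs (w.1.adicCompletion L) ((((h * g * h⁻¹ : Gqs L v).val : GL (Fin 3) (UnitaryGroup.LocalRing L v)).val.charpoly.discr) w)) *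
          ((∏ w : PlacesOver L v, IsNonarchimedeanLocalField.normAbs (w.1.adicCompletion L) ((((h * g * h⁻¹ : Gqs L v).val : GL (Fin 3) (UnitaryGroup.LocalRing L v)).val.det) w)) ^ 2)⁻¹) =
      NNReal.sqrt
        ((∏ w : PlacesOver L v, IsNonarchimedeanLocalField.normAbs (w.1.adicCompletion L) (((g.val : GL (Fin 3) (UnitaryGroup.LocalRing L v)).val.charpoly.discr) w)) *
          ((∏ w : PlacesOver L v, IsNonarchimedeanLocalField.normAbs (w.1.adicCompletion L) (((g.val : GL (Fin 3) (UnitaryGroup.LocalRing L v)).val.det) w)) ^ 2)⁻¹) := by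
  have hval : ((h * g * h⁻¹ : Gqs L v).val : GL (Fin 3) (UnitaryGroup.LocalRing L v)).val =
      (h.val : GL (Fin 3) (UnitaryGroup.LocalRing L v)).val * (g.val : GL (Fin 3) (UnitaryGroup.LocalRing L v)).val *
        (h.val : GL (Fin 3) (UnitaryGroup.LocalRing L v))⁻¹.val := rfl
  have hdisc : ((h * g * h⁻¹ : Gqs L v).val : GL (Fin 3) (UnitaryGroup.LocalRing L v)).val.charpoly.discr =
      (g.val : GL (Fin 3) (UnitaryGroup.LocalRing L v)).val.charpoly.discr := by
    rw [hval, F0P3cStCharTSDGFieldReg.charpoly_discr_units_conj]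
  have hdet : ((h * g * h⁻¹ : Gqs L v).val : GL (Fin 3) (UnitaryGroup.LocalRing L v)).val.det =
      (g.val : GL (Fin 3) (UnitaryGroup.LocalRing L v)).val.det := by
    rw [hval, Matrix.det_units_conj]
  rw [hdisc, hdet]

/-- **On the split torus the weight letter is `(Re Δ)²`** — datum-free form of ★ DG-FIELD `DG_coe_torus_eq_vanDijkWeight_re`: at regular `t ∈ M` the Harish-Chandra antecedent
`u·det(t)² = discr(χ_t)` holds (★ `exists_unit_mul_det_sq_eq_discr_iff`) and `√√‖u‖ = Re Δ(t)` (★ `coe_sqrt_sqrt_unitModulusChar_eq_vanDijkWeight_re`, ★ `dgFormula_eq_of_unit_rel`);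
at singular `t` both sides vanish (★ `vanDijkWeight_eq_zero_of_not`, ★ `dgFormula_eq_zero_of_not_isUnit_discr`).  This is the `hDM` input of ★ (J6) FILE 7.
[cite: Rogawski1990, §12.7 Lemma 12.7.2 (proof) p. 193; §4.9 (4.9.4) p. 56; §12.5 p. 182] -/
theorem sqrt_dgRadicand_coe_torus_eq_vanDijkWeight_re_sq (hns : ∀ w : PlacesOver L v, IsCMField.complexConj L • w.1 = w.1)
    (t : ↥(cmBorelTriple L 3 v).M) :
    ((NNReal.sqrt
        ((∏ w : PlacesOver L v, IsNonarchimedeanLocalField.normAbs (w.1.adicCompletion L)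
            (((((t : ↥(unitaryGroupOfForm (conjLocal L (IsCMField.complexConj L) v) (cmLocalForm L 3 v))) : Gqs L v).val : GL (Fin 3) (UnitaryGroup.LocalRing L v)).val.charpoly.discr) w)) *
          ((∏ w : PlacesOver L v, IsNonarchimedeanLocalField.normAbs (w.1.adicCompletion L)
            (((((t : ↥(unitaryGroupOfForm (conjLocal L (IsCMField.complexConj L) v) (cmLocalForm L 3 v))) : Gqs L v).val : GL (Fin 3) (UnitaryGroup.LocalRing L v)).val.det) w)) ^ 2)⁻¹) : ℝ≥0) : ℝ) =
      ((F0P3cStCharTSTorusDefs.vanDijkWeight L v t).re) ^ 2 := by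
  -- the closed form `dg = √√radicand` at `t`, so that `dg² = √radicand`
  have hsq : ((NNReal.sqrt
        ((∏ w : PlacesOver L v, IsNonarchimedeanLocalField.normAbs (w.1.adicCompletion L)
            (((((t : ↥(unitaryGroupOfForm (conjLocal L (IsCMField.complexConj L) v) (cmLocalForm L 3 v))) : Gqs L v).val : GL (Fin 3) (UnitaryGroup.LocalRing L v)).val.charpoly.discr) w)) *
          ((∏ w : PlacesOver L v, IsNonarchimedeanLocalField.normAbs (w.1.adicCompletion L)
            (((((t : ↥(unitaryGroupOfForm (conjLocal L (IsCMField.complexConj L) v) (cmLocalForm L 3 v))) : Gqs L v).val : GL (Fin 3) (UnitaryGroup.LocalRing L v)).val.det) w)) ^ 2)⁻¹) : ℝ≥0) : ℝ) =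
      (((NNReal.sqrt (NNReal.sqrt
        ((∏ w : PlacesOver L v, IsNonarchimedeanLocalField.normAbs (w.1.adicCompletion L)
            (((((t : ↥(unitaryGroupOfForm (conjLocal L (IsCMField.complexConj L) v) (cmLocalForm L 3 v))) : Gqs L v).val : GL (Fin 3) (UnitaryGroup.LocalRing L v)).val.charpoly.discr) w)) *
          ((∏ w : PlacesOver L v, IsNonarchimedeanLocalField.normAbs (w.1.adicCompletion L)
            (((((t : ↥(unitaryGroupOfForm (conjLocal L (IsCMField.complexConj L) v) (cmLocalForm L 3 v))) : Gqs L v).val : GL (Fin 3) (UnitaryGroup.LocalRing L v)).val.det) w)) ^ 2)⁻¹)) : ℝ≥0) : ℝ)) ^ 2 := by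
    rw [← NNReal.coe_pow, NNReal.sq_sqrt]
  rw [hsq]
  congr 1
  -- `dg(t) = Re Δ(t)` (★ DG-FIELD's proof, datum-free)
  rcases Classical.em (IsUnit ((((torusEntry (conjLocal L (IsCMField.complexConj L) v) (cmLocalForm L 3 v) 0 t)⁻¹ *
        torusEntry (conjLocal L (IsCMField.complexConj L) v) (cmLocalForm L 3 v) 1 t : (UnitaryGroup.LocalRing L v)ˣ) : UnitaryGroup.LocalRing L v) - 1) ∧
      IsUnit ((((torusEntry (conjLocal L (IsCMField.complexConj L) v) (cmLocalForm L 3 v) 0 t)⁻¹ *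
        torusEntry (conjLocal L (IsCMField.complexConj L) v) (cmLocalForm L 3 v) 2 t : (UnitaryGroup.LocalRing L v)ˣ) : UnitaryGroup.LocalRing L v) - 1)) with hreg | hreg
  · obtain ⟨u, hu⟩ := (F0P3cStCharTSVanDijkHC.exists_unit_mul_det_sq_eq_discr_iff L v hns t).2 hreg
    rw [F0P3cStCharTSDGField.dgFormula_eq_of_unit_rel L v _ u hu]
    exact F0P3cStCharTSVanDijkHC.coe_sqrt_sqrt_unitModulusChar_eq_vanDijkWeight_re L v hns t u hu
  · have h0 : ¬ IsUnit ((((t : ↥(unitaryGroupOfForm (conjLocal L (IsCMField.complexConj L) v) (cmLocalForm L 3 v))) : Gqs L v).val :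
        GL (Fin 3) (UnitaryGroup.LocalRing L v)).val.charpoly.discr) := fun hdisc =>
      hreg ((F0P3cStCharTSVanDijkHC.exists_unit_mul_det_sq_eq_discr_iff L v hns t).1 ((F0P3cStCharTSDGField.exists_unit_rel_iff_isUnit_discr L v _).2 hdisc))
    rw [F0P3cStCharTSVanDijkWeylSymm.vanDijkWeight_eq_zero_of_not L v t hreg, Complex.zero_re]
    exact F0P3cStCharTSDGField.dgFormula_eq_zero_of_not_isUnit_discr L v _ h0

/-! ## §2 The socket at ANY Cartan `T = Z(γ₀)` -/

set_option maxHeartbeats 3200000 in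
set_option synthInstance.maxHeartbeats 400000 in
-- long socket statement and instance-term unification on the CM local carrier (class of ★ C8 ∕ ★ (J6) FILE 7 ∕ ★ (E1b))
/-- **(N4-A) THE LOCAL TUBE-JACOBIAN SOCKET AT ANY CARTAN** `T = Z(γ₀)` of `G = Gqs L v = U(Φ₃)(L⁺_v)` (`γ₀` regular, `v` non-split — `T` compact OR a conjugate of the split torus
`M`): for every Haar measure `tT` of `T` with inversion symmetry and `tT (compactCore T) = 1` and every conjugation family `Φ (xT, t) = x t x⁻¹`, every regular `t₀ ∈ T` has an open
`U ∋ t₀` in `T` and a Borel `A₀ ⊆ G ⧸ T` with `0 < (ν∕tT)(A₀) < ∞` such that for all Borel, regular, `W`-free `V ⊆ U`,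
`ν (Φ '' (A₀ ×ˢ V)) = (ν∕tT)(A₀) · ∫⁻_V √(∏_w |disc χ_t|_w (∏_w |det t|_w)⁻²) dtT` — the `hJacLoc` binder of ★ (E1b) `lintegral_cartanSet_eq_of_tubeJacobian_local` at the weight letter, PAID.
Compact `T`: ★ C8 `tubeJacobianSocket_compactCartan`.  Non-compact `T = x M x⁻¹`: ★ (J6) FILE 7 at `(Int(x⁻¹)_* ν, (Int(x⁻¹)|_T)_* tT)` on `M`, pulled back by ★ (Q9).
[cite: HarishChandra1970, Lemma 22] [cite: Rogawski1990, §12.5 p. 182; §3.6 p. 29] -/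
theorem tubeJacobianSocket_cartan
    (hns : ∀ w : PlacesOver L v, IsCMField.complexConj L • w.1 = w.1)
    [MeasurableSpace (Gqs L v)] [BorelSpace (Gqs L v)] [LocallyCompactSpace (Gqs L v)] [SecondCountableTopology (Gqs L v)] [T2Space (Gqs L v)]
    (ν : Measure (Gqs L v)) [ν.IsHaarMeasure] [ν.IsMulRightInvariant]
    {T : Subgroup (Gqs L v)} {γ₀ : Gqs L v} (hγ₀ : IsRegularElt (γ₀.val : GL (Fin 3) (UnitaryGroup.LocalRing L v)))
    (hT : T = Subgroup.centralizer ({γ₀} : Set (Gqs L v)))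
    [MeasurableSpace (Gqs L v ⧸ T)] [BorelSpace (Gqs L v ⧸ T)]
    (tT : Measure ↥T) [tT.IsHaarMeasure] [tT.IsInvInvariant] (htT : tT (compactCore ↥T) = 1)
    (Φ : (Gqs L v ⧸ T) × ↥T → Gqs L v) (hΦ : ∀ (x : Gqs L v) (t : ↥T), Φ (QuotientGroup.mk x, t) = x * t * x⁻¹) :
    ∀ t₀ : ↥T, IsRegularElt (((t₀ : Gqs L v)).val : GL (Fin 3) (UnitaryGroup.LocalRing L v)) →
      ∃ U : Set ↥T, IsOpen U ∧ t₀ ∈ U ∧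
        ∃ A₀ : Set (Gqs L v ⧸ T), MeasurableSet A₀ ∧ (quotientMeasure T tT (isClosed_cartan hT) ν) A₀ ≠ 0 ∧
          (quotientMeasure T tT (isClosed_cartan hT) ν) A₀ ≠ ∞ ∧
          ∀ V : Set ↥T, MeasurableSet V → V ⊆ U → (∀ t ∈ V, IsRegularElt (((t : Gqs L v)).val : GL (Fin 3) (UnitaryGroup.LocalRing L v))) →
            (∀ n : Gqs L v, n ∉ T → ∀ t ∈ V, ∀ t' ∈ V, ((t' : ↥T) : Gqs L v) ≠ n * t * n⁻¹) →
              ν (Φ '' (A₀ ×ˢ V)) = (quotientMeasure T tT (isClosed_cartan hT) ν) A₀ *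
                ∫⁻ t in V, ((NNReal.sqrt
                    ((∏ w : PlacesOver L v, IsNonarchimedeanLocalField.normAbs (w.1.adicCompletion L)
                        ((((t : Gqs L v).val : GL (Fin 3) (UnitaryGroup.LocalRing L v)).val.charpoly.discr) w)) *
                      ((∏ w : PlacesOver L v, IsNonarchimedeanLocalField.normAbs (w.1.adicCompletion L)
                        ((((t : Gqs L v).val : GL (Fin 3) (UnitaryGroup.LocalRing L v)).val.det) w)) ^ 2)⁻¹) : ℝ≥0) : ℝ≥0∞) ∂tT := by
  classical
  have hTcl := isClosed_cartan hT
  -- the ambient σ-algebra on `G ⧸ T` IS the Borel one (used to read ★ C8, which fixes `borel`)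
  obtain ⟨hBq⟩ := ‹BorelSpace (Gqs L v ⧸ T)›
  by_cases hc : IsCompact (T : Set (Gqs L v))
  · -- ### compact Cartan: ★ C8, its set-builder tube rewritten as `Φ '' (A₀ ×ˢ V)`
    subst hBq
    intro t₀ ht₀
    obtain ⟨U, hUo, ht₀U, A₀, hA₀m, hA₀0, hA₀top, hJ⟩ :=
      F0P3cStCharTSJacCartanTerminus.tubeJacobianSocket_compactCartan L v hns ν T γ₀ hγ₀ hT hc tT ‹_› ‹_› htT t₀ ht₀
    refine ⟨U, hUo, ht₀U, A₀, hA₀m, hA₀0, hA₀top, fun V hVm hVU hVreg hVW => ?_⟩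
    have htube : Φ '' (A₀ ×ˢ V) = {y : Gqs L v | ∃ (x : Gqs L v) (t : ↥T), (QuotientGroup.mk x : Gqs L v ⧸ T) ∈ A₀ ∧ t ∈ V ∧ y = x * t * x⁻¹} := by
      ext y
      constructor
      · rintro ⟨⟨q, t⟩, ⟨hq, ht⟩, rfl⟩
        obtain ⟨x, rfl⟩ := QuotientGroup.mk_surjective q
        exact ⟨x, t, hq, ht, hΦ x t⟩
      · rintro ⟨x, t, hx, ht, rfl⟩
        exact ⟨(QuotientGroup.mk x, t), ⟨hx, ht⟩, hΦ x t⟩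
    rw [htube]
    exact hJ V hVm hVU hVreg hVW
  · -- ### non-compact Cartan: `T = Z(γ₀) = x M x⁻¹`; transport the `M`-socket along `e := Int(x⁻¹)`
    -- the split torus READ ON THE ORGAN CARRIER `Gqs L v` (the matrix carrier of ★ EllCartanCompact ∕ ★ CartanReps IS `Gqs L v`, definitionally)
    obtain ⟨M', hM'⟩ : ∃ M' : Subgroup (Gqs L v), M' = (cmBorelTriple L 3 v).M := ⟨_, rfl⟩
    obtain ⟨x₀, m, -, -, hZ₀⟩ := F0P3cStCharTSEllCartanCompact.exists_conj_cmTorus_of_not_isCompact_centralizer L v hns hγ₀ (hT ▸ hc)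
    obtain ⟨x, hx⟩ : ∃ x : Gqs L v, x = x₀ := ⟨x₀, rfl⟩
    have hZ : ∀ g : Gqs L v, g ∈ Subgroup.centralizer ({γ₀} : Set (Gqs L v)) ↔ x⁻¹ * g * x ∈ M' := by
      intro g; rw [hM']; subst hx; exact hZ₀ g
    -- `M' = Z(m₀)` for a regular `m₀` (★ CartanReps): closed, abelian; its conjugation family
    obtain ⟨m₀, -, hm₀reg, hZm₀⟩ := F0P3cStCharTSCartanReps.exists_isRegularElt_centralizer_eq_cmTorus L v hns
    obtain ⟨m₁, hm₁⟩ : ∃ m₁ : Gqs L v, m₁ = m₀ := ⟨m₀, rfl⟩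
    have hm₁reg : IsRegularElt (m₁.val : GL (Fin 3) (UnitaryGroup.LocalRing L v)) := by subst hm₁; exact hm₀reg
    have hM'Z : M' = Subgroup.centralizer ({m₁} : Set (Gqs L v)) := by
      rw [hM']; subst hm₁; exact hZm₀.symm
    have hMcl : IsClosed (M' : Set (Gqs L v)) := isClosed_cartan hM'Z
    have hMab : ∀ a ∈ M', ∀ b ∈ M', a * b = b * a := mul_comm_cartan hm₁reg hM'Z
    obtain ⟨Φ', hΦ'⟩ := exists_conjFamily M' hMab
    -- `e := Int(x⁻¹) : G ≃* G`, `e g = x⁻¹ g x`, continuous both ways; `e(T) = M'`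
    set e : Gqs L v ≃* Gqs L v := MulAut.conj x⁻¹ with he_def
    have he_apply : ∀ g : Gqs L v, e g = x⁻¹ * g * x := fun g => by
      rw [he_def, MulAut.conj_apply, inv_inv]
    have he : Continuous e := by
      have : (⇑e : Gqs L v → Gqs L v) = fun g => x⁻¹ * g * x := funext he_apply
      rw [this]; fun_prop
    have hes : Continuous e.symm := by
      have : (⇑e.symm : Gqs L v → Gqs L v) = fun g => x * g * x⁻¹ := by
        funext g; rw [he_def, MulAut.conj_symm_apply, inv_inv]
      rw [this]; fun_prop
    have hem : Measurable e := he.measurable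
    have hTT' : ∀ g : Gqs L v, e g ∈ M' ↔ g ∈ T := fun g => by
      rw [he_apply, hT]; exact (hZ g).symm
    -- the transported measures `ν' = e_* ν`, `tm' = (e|_T)_* tT` and their Haar-type instances (★ (Q9) kit)
    letI : MeasurableSpace (Gqs L v ⧸ M') := borel _
    haveI : BorelSpace (Gqs L v ⧸ M') := ⟨rfl⟩
    set ν' : Measure (Gqs L v) := Measure.map e ν with hν'
    haveI : ν'.IsHaarMeasure := isHaarMeasure_map_mulEquiv e he hes ν
    haveI : ν'.IsMulRightInvariant := isMulRightInvariant_map_mulEquiv e hem ν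
    set eT := subgroupCongrHomeomorph e T M' hTT' he hes with heT
    -- `e|_T` as an isomorphism of topological groups
    let eT' : ↥T ≃ₜ* ↥M' :=
      { toMulEquiv :=
          { toEquiv := eT.toEquiv
            map_mul' := fun a b => Subtype.ext (by
              show ((eT (a * b) : ↥M') : Gqs L v) = (eT a : Gqs L v) * (eT b : Gqs L v)
              rw [heT, coe_subgroupCongrHomeomorph_apply, coe_subgroupCongrHomeomorph_apply, coe_subgroupCongrHomeomorph_apply, Subgroup.coe_mul, map_mul]) }
        continuous_toFun := eT.continuous
        continuous_invFun := eT.symm.continuous }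
    have heT' : (⇑eT' : ↥T → ↥M') = ⇑eT := rfl
    set tm' : Measure ↥M' := Measure.map eT tT with htm'
    haveI hTlc : LocallyCompactSpace ↥T := hTcl.isClosedEmbedding_subtypeVal.locallyCompactSpace
    haveI : LocallyCompactSpace ↥M' := hMcl.isClosedEmbedding_subtypeVal.locallyCompactSpace
    haveI : SecondCountableTopology ↥M' := TopologicalSpace.Subtype.secondCountableTopology _
    haveI : tm'.IsHaarMeasure := by
      rw [htm', ← heT']; exact ContinuousMulEquiv.isHaarMeasure_map tT eT'
    haveI : tm'.IsInvInvariant := isInvInvariant_map_subgroupCongr e he hes T M' hTT' tT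
    have htm'1 : tm' (compactCore ↥M') = 1 := by
      have hme : MeasurableEmbedding (⇑eT') := eT'.toHomeomorph.measurableEmbedding
      rw [htm', ← heT', ← image_compactCore eT', hme.map_apply, eT'.injective.preimage_image, htT]
    -- the `M`-socket at `(ν', tm')` with the weight letter (★ (J6) FILE 7, `hDM` by §1)
    obtain ⟨w₀, hw₀⟩ := F0P3cStCharTSVanDijkWeylSymm.exists_weylElt L v
    have hJacM := F0P3cStCharTSWeylHypJacobianCartanM.tubeJacobianLocal_cartan_Gqs_vanDijkWeight_sq L v hns ν' hM' hMcl Φ' hΦ' tm' htm'1 w₀ hw₀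
      (fun t' => NNReal.sqrt
        ((∏ w : PlacesOver L v, IsNonarchimedeanLocalField.normAbs (w.1.adicCompletion L)
            (((((t' : ↥(unitaryGroupOfForm (conjLocal L (IsCMField.complexConj L) v) (cmLocalForm L 3 v))) : Gqs L v).val : GL (Fin 3) (UnitaryGroup.LocalRing L v)).val.charpoly.discr) w)) *
          ((∏ w : PlacesOver L v, IsNonarchimedeanLocalField.normAbs (w.1.adicCompletion L)
            (((((t' : ↥(unitaryGroupOfForm (conjLocal L (IsCMField.complexConj L) v) (cmLocalForm L 3 v))) : Gqs L v).val : GL (Fin 3) (UnitaryGroup.LocalRing L v)).val.det) w)) ^ 2)⁻¹))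
      (fun t => NNReal.sqrt
        ((∏ w : PlacesOver L v, IsNonarchimedeanLocalField.normAbs (w.1.adicCompletion L)
            ((((t : Gqs L v).val : GL (Fin 3) (UnitaryGroup.LocalRing L v)).val.charpoly.discr) w)) *
          ((∏ w : PlacesOver L v, IsNonarchimedeanLocalField.normAbs (w.1.adicCompletion L)
            ((((t : Gqs L v).val : GL (Fin 3) (UnitaryGroup.LocalRing L v)).val.det) w)) ^ 2)⁻¹))
      (fun t t' h => by simp only [h]) (sqrt_dgRadicand_coe_torus_eq_vanDijkWeight_re_sq L v hns)
    -- ★ (Q9) pull-back along `e` (`Φ`-compatibility ★ `map_conjFamily_eq_conjFamily`, regularity ★ `isRegularElt_conj_val_iff`, weight §1 `sqrt_dgRadicand_conj`)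
    exact tubeJacobianLocal_of_mulEquiv_map_nnreal e he hes T hTcl M' hMcl hTT' ν ν' tT tm' hν' htm' Φ Φ'
      (map_conjFamily_eq_conjFamily e he hes T M' hTT' Φ hΦ Φ' hΦ')
      (fun g : Gqs L v => IsRegularElt (g.val : GL (Fin 3) (UnitaryGroup.LocalRing L v)))
      (fun g : Gqs L v => IsRegularElt (g.val : GL (Fin 3) (UnitaryGroup.LocalRing L v)))
      (fun g => by
        show IsRegularElt ((e g).val : GL (Fin 3) (UnitaryGroup.LocalRing L v)) ↔ IsRegularElt (g.val : GL (Fin 3) (UnitaryGroup.LocalRing L v))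
        rw [he_apply]
        simpa only [inv_inv] using isRegularElt_conj_val_iff L v x⁻¹ g)
      (fun t => NNReal.sqrt
        ((∏ w : PlacesOver L v, IsNonarchimedeanLocalField.normAbs (w.1.adicCompletion L)
            ((((t : Gqs L v).val : GL (Fin 3) (UnitaryGroup.LocalRing L v)).val.charpoly.discr) w)) *
          ((∏ w : PlacesOver L v, IsNonarchimedeanLocalField.normAbs (w.1.adicCompletion L)
            ((((t : Gqs L v).val : GL (Fin 3) (UnitaryGroup.LocalRing L v)).val.det) w)) ^ 2)⁻¹))
      (fun t => NNReal.sqrt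
        ((∏ w : PlacesOver L v, IsNonarchimedeanLocalField.normAbs (w.1.adicCompletion L)
            ((((t : Gqs L v).val : GL (Fin 3) (UnitaryGroup.LocalRing L v)).val.charpoly.discr) w)) *
          ((∏ w : PlacesOver L v, IsNonarchimedeanLocalField.normAbs (w.1.adicCompletion L)
            ((((t : Gqs L v).val : GL (Fin 3) (UnitaryGroup.LocalRing L v)).val.det) w)) ^ 2)⁻¹))
      (fun t => by
        show NNReal.sqrt _ = NNReal.sqrt _
        have h1 : ((eT t : ↥M') : Gqs L v) = x⁻¹ * (t : Gqs L v) * x⁻¹⁻¹ := by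
          rw [heT, coe_subgroupCongrHomeomorph_apply, he_apply, inv_inv]
        rw [h1]
        exact sqrt_dgRadicand_conj L v (t : Gqs L v) x⁻¹)
      hJacM

end CM

end Summit.HodgeConjecture.HodgeConjecture.Cruxes.H413.F0P3cStCharTSUpTrTubeSocketAnyCartan

end
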